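import Literature.AnabelianGeometry.AbsoluteAnabelian.DiagramsOfCategories
import Literature.AnabelianGeometry.AbsoluteAnabelian.DiagramComap
import Literature.AnabelianGeometry.AbsoluteAnabelian.DiagramMorphisms

/-!
# Self-equivalences of a diagram of categories along a graph automorphism under which the diagram is
# INVARIANT, and their compatibility with invariant families of homotopies ([AbsTopIII] Def. 3.5 (v))

S. Mochizuki, *Topics in Absolute Anabelian Geometry III*, Def. 3.5 (i), (ii), (v) pp. 74–77 of the kurims
manuscript (`paper:url-5493eb38cbb7`; bib key `MochizukiAbsTopIII2015`).  Generic bookkeeping (seat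
abc-iut-w6-d023; toolkit for the literal compatibility sentence of Cor. 3.6 (v) / 4.5 (v),
`LogFrobeniusData.ShiftCompatStmt` of `AbsTopIII/FrobeniusPictureMLFCompatibility.lean`): the nexus
self-equivalences `Φ_m` of Cor. 3.6 (v) translate the first row of `Γ⃗_𝒟` and are the IDENTITY on the
categories (`AbsTopIII/FrobeniusPictureMLFShift.lean`); print's "compatible with the families of homotopies
[...] of (i), (iii)" (Def. 3.5 (v): `Φ_Γ⃗` induces a bijection of the boundary sets and the homotopies
commute with the `Φ_e`) then says exactly that those families are INVARIANT under the translation.  This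
file makes that reduction a construction, for any diagram `𝒟` on `Γ⃗`, any morphism of oriented graphs
`F : Γ⃗ → Γ⃗` under which `𝒟` is invariant (`F^*𝒟 = 𝒟`, cf. `DiagramComap.lean`) and any 1-morphism
`Φ : 𝒟 → 𝒟` over `F` with identity vertex functors and `eqToHom` edge 2-cells:

* `OneMorphism.pathIso'` — the isomorphisms `Φ_{[γ]} : Φ_{v₁} ⋙ 𝒟_{F[γ]} ≅ 𝒟_{[γ]} ⋙ Φ_{v₂}` composed from
  the `Φ_e` (the datum `pathIso` of `OneMorphism.CompatibleWith`, forced by its defining clauses), with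
  `eqToHom` components when the `Φ_e` have (`pathIso'_hom_app`);
* `OneMorphism.compatibleWithOfInvariant` — `Φ.CompatibleWith K K'` from: `F^*𝒟 = 𝒟`, `Φ_v ≍ 𝟭`,
  `Φ_e` componentwise `eqToHom`, `F` surjective on paths, and the INVARIANCE of the pair `(K, K')`:
  `E_K(p,q) ↔ E_{K'}(Fp,Fq)` and `ζ^{K'}_{(Fp,Fq)} ≍ ζ^K_{(p,q)}`;
* `Prefunctor.exists_mapPath_eq_of_inverse` — a graph morphism with a two-sided inverse is surjective on
  paths; `HomotopyFamily.E_mapPath_iff_of_inverse` — one-sided invariance of a boundary set under two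
  mutually inverse graph morphisms gives the bijection;
* a handful of heterogeneous-equality congruences for functor categories whose object types vary along a
  propositional equality (the categories `𝒟_{F v}` and `𝒟_v` agree only propositionally in `v`).

Sequel `DiagramShiftInvarianceLifts.lean`: invariance of the lifts of `DiagramLifts.lean` and of the universal
family of `DiagramUniversalFamilies.lean`.  Pure category-theoretic plumbing; no claim of the paper is asserted;
nothing here bears on [IUTchIII] Cor. 3.12.
-/

namespace Literature.AnabelianGeometry.AbsoluteAnabelian

open _root_.CategoryTheory _root_.Quiver

universe v u w w'

/-! ### Heterogeneous congruences across propositionally equal categories -/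

section HEqToolkit

/-- Components of heterogeneously equal natural transformations (between heterogeneously equal functors of
propositionally equal categories) at heterogeneously equal objects agree. [cite: MochizukiAbsTopIII2015, Definition 3.5 (ii) p.75] -/
theorem NatTrans.app_heq_of_heq {A A' B B' : Type u} [iA : Category.{v} A] [iA' : Category.{v} A']
    [iB : Category.{v} B] [iB' : Category.{v} B'] (hA : A = A') (hiA : HEq iA iA') (hB : B = B')
    (hiB : HEq iB iB') {P Q : A ⥤ B} {P' Q' : A' ⥤ B'} (hP : HEq P P') (hQ : HEq Q Q')
    {θ : P ⟶ Q} {θ' : P' ⟶ Q'} (hθ : HEq θ θ') {x : A} {x' : A'} (hx : HEq x x') :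
    HEq (θ.app x) (θ'.app x') := by
  subst hA; subst hB; cases hiA; cases hiB; cases hP; cases hQ; cases hθ; cases hx; rfl

/-- A functor heterogeneously equal to the identity fixes objects (heterogeneously). [cite: MochizukiAbsTopIII2015, Definition 3.5 (ii) p.75] -/
theorem Functor.obj_heq_of_heq_id {C C' : Type u} [i : Category.{v} C] [i' : Category.{v} C']
    (hC : C' = C) (hi : HEq i' i) {G : C ⥤ C'} (hG : HEq G (𝟭 C)) (x : C) : HEq (G.obj x) x := by
  subst hC; cases hi; cases hG; rfl

/-- A functor heterogeneously equal to the identity fixes morphisms (heterogeneously). [cite: MochizukiAbsTopIII2015, Definition 3.5 (ii) p.75] -/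
theorem Functor.map_heq_of_heq_id {C C' : Type u} [i : Category.{v} C] [i' : Category.{v} C']
    (hC : C' = C) (hi : HEq i' i) {G : C ⥤ C'} (hG : HEq G (𝟭 C)) {x y : C} (f : x ⟶ y) :
    HEq (G.map f) f := by
  subst hC; cases hi; cases hG; rfl

/-- Right whiskering respects heterogeneous equality, the source and target categories varying along
propositional equalities. [cite: MochizukiAbsTopIII2015, Definition 3.5 (ii) p.75] -/
theorem Functor.whiskerRight_heq' {A A' B C C' : Type u} [iA : Category.{v} A] [iA' : Category.{v} A']
    [Category.{v} B] [iC : Category.{v} C] [iC' : Category.{v} C'] (hA : A = A') (hiA : HEq iA iA')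
    (hC : C = C') (hiC : HEq iC iC') {F G : A ⥤ B} {F' G' : A' ⥤ B} (hF : HEq F F') (hG : HEq G G')
    {α : F ⟶ G} {α' : F' ⟶ G'} (hα : HEq α α') {T : B ⥤ C} {T' : B ⥤ C'} (hT : HEq T T') :
    HEq (Functor.whiskerRight α T) (Functor.whiskerRight α' T') := by
  subst hA; subst hC; cases hiA; cases hiC; cases hF; cases hG; cases hα; cases hT; rfl

/-- Right whiskering respects heterogeneous equality, all three categories varying along propositional
equalities. [cite: MochizukiAbsTopIII2015, Definition 3.5 (ii) p.75] -/
theorem Functor.whiskerRight_heq'' {A A' B B' C C' : Type u} [iA : Category.{v} A] [iA' : Category.{v} A']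
    [iB : Category.{v} B] [iB' : Category.{v} B'] [iC : Category.{v} C] [iC' : Category.{v} C']
    (hA : A = A') (hiA : HEq iA iA') (hB : B = B') (hiB : HEq iB iB') (hC : C = C') (hiC : HEq iC iC')
    {F G : A ⥤ B} {F' G' : A' ⥤ B'} (hF : HEq F F') (hG : HEq G G') {α : F ⟶ G} {α' : F' ⟶ G'}
    (hα : HEq α α') {T : B ⥤ C} {T' : B' ⥤ C'} (hT : HEq T T') :
    HEq (Functor.whiskerRight α T) (Functor.whiskerRight α' T') := by
  subst hA; subst hB; subst hC; cases hiA; cases hiB; cases hiC; cases hF; cases hG; cases hα; cases hT; rfl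

/-- Left whiskering respects heterogeneous equality, the outer categories varying along propositional
equalities. [cite: MochizukiAbsTopIII2015, Definition 3.5 (ii) p.75] -/
theorem Functor.whiskerLeft_heq' {A A' B C C' : Type u} [iA : Category.{v} A] [iA' : Category.{v} A']
    [Category.{v} B] [iC : Category.{v} C] [iC' : Category.{v} C'] (hA : A = A') (hiA : HEq iA iA')
    (hC : C = C') (hiC : HEq iC iC') {R : A ⥤ B} {R' : A' ⥤ B} (hR : HEq R R') {F G : B ⥤ C}
    {F' G' : B ⥤ C'} (hF : HEq F F') (hG : HEq G G') {α : F ⟶ G} {α' : F' ⟶ G'} (hα : HEq α α') :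
    HEq (Functor.whiskerLeft R α) (Functor.whiskerLeft R' α') := by
  subst hA; subst hC; cases hiA; cases hiC; cases hR; cases hF; cases hG; cases hα; rfl

/-- Composition of natural transformations respects heterogeneous equality across propositionally equal
functor categories. [cite: MochizukiAbsTopIII2015, Definition 3.5 (ii) p.75] -/
theorem NatTrans.comp_heq' {A A' B B' : Type u} [iA : Category.{v} A] [iA' : Category.{v} A']
    [iB : Category.{v} B] [iB' : Category.{v} B'] (hA : A = A') (hiA : HEq iA iA') (hB : B = B')
    (hiB : HEq iB iB') {P Q R : A ⥤ B} {P' Q' R' : A' ⥤ B'} (hP : HEq P P') (hQ : HEq Q Q')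
    (hR : HEq R R') {θ : P ⟶ Q} {θ' : P' ⟶ Q'} (hθ : HEq θ θ') {κ : Q ⟶ R} {κ' : Q' ⟶ R'}
    (hκ : HEq κ κ') : HEq (θ ≫ κ) (θ' ≫ κ') := by
  subst hA; subst hB; cases hiA; cases hiB; cases hP; cases hQ; cases hR; cases hθ; cases hκ; rfl

/-- Identities of heterogeneously equal functors agree. [cite: MochizukiAbsTopIII2015, Definition 3.5 (ii) p.75] -/
theorem NatTrans.id_heq' {A A' B B' : Type u} [iA : Category.{v} A] [iA' : Category.{v} A']
    [iB : Category.{v} B] [iB' : Category.{v} B'] (hA : A = A') (hiA : HEq iA iA') (hB : B = B')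
    (hiB : HEq iB iB') {P : A ⥤ B} {P' : A' ⥤ B'} (hP : HEq P P') :
    HEq (𝟙 P : P ⟶ P) (𝟙 P' : P' ⟶ P') := by
  subst hA; subst hB; cases hiA; cases hiB; cases hP; rfl

/-- An `eqToHom`-sandwich is heterogeneously equal to any heterogeneously equal core, across categories.
[cite: MochizukiAbsTopIII2015, Definition 3.5 (ii) p.75] -/
theorem eqToHom_comp_comp_eqToHom_heq_of_heq {C : Type u} [Category.{v} C] {D : Type u}
    [Category.{v} D] {a a' b b' : C} (ha : a = a') (hb : b' = b) (f : a' ⟶ b') {x y : D} {g : x ⟶ y}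
    (hfg : HEq f g) : HEq (eqToHom ha ≫ f ≫ eqToHom hb) g := by
  subst ha; subst hb; simpa using hfg

end HEqToolkit

/-! ### A graph morphism with a two-sided inverse is surjective on paths -/

/-- Paths are mapped heterogeneously equally by equal graph morphisms. [cite: MochizukiAbsTopIII2015, Section 0 p.26] -/
theorem Prefunctor.mapPath_heq_of_eq {V : Type w} [Quiver.{v} V] {W : Type w'} [Quiver.{v} W]
    {F G : V ⥤q W} (h : F = G) {a b : V} (p : Path a b) : HEq (F.mapPath p) (G.mapPath p) := by
  subst h; rfl

/-- A morphism of oriented graphs with a two-sided inverse is surjective on paths between any two image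
vertices (used for `Φ_Γ⃗` "induces a bijection between the boundary sets", Def. 3.5 (v)).
[cite: MochizukiAbsTopIII2015, Definition 3.5 (v) p.76] -/
theorem Prefunctor.exists_mapPath_eq_of_inverse {V : Type w} [Quiver.{v} V] {F G : V ⥤q V}
    (h₁ : F ⋙q G = 𝟭q V) (h₂ : G ⋙q F = 𝟭q V) {a b : V} (p' : Path (F.obj a) (F.obj b)) :
    ∃ p : Path a b, F.mapPath p = p' := by
  have ha : G.obj (F.obj a) = a := congrArg (fun H : V ⥤q V => H.obj a) h₁
  have hb : G.obj (F.obj b) = b := congrArg (fun H : V ⥤q V => H.obj b) h₁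
  refine ⟨(ha ▸ hb ▸ G.mapPath p' : Path a b), ?_⟩
  have key : HEq (F.mapPath (G.mapPath p')) p' := by
    have e := (Prefunctor.mapPath_comp_apply G F p').symm
    rw [e]
    exact (Prefunctor.mapPath_heq_of_eq h₂ p').trans (heq_of_eq (Prefunctor.mapPath_id p'))
  have aux : ∀ {a₀ b₀ : V} (ha : a₀ = a) (hb : b₀ = b) (q : Path a₀ b₀),
      HEq (F.mapPath (ha ▸ hb ▸ q : Path a b)) (F.mapPath q) := by
    intro a₀ b₀ ha hb q; subst ha; subst hb; rfl
  exact eq_of_heq ((aux ha hb (G.mapPath p')).trans key)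

namespace DiagramOfCategories

variable {V : Type w} [Quiver.{v} V]

/-! ### Invariance of a diagram along a graph morphism: consequences of `F^*𝒟 = 𝒟` -/

/-- Equal diagrams have the same category structures at each vertex (heterogeneously). [cite: MochizukiAbsTopIII2015, Definition 3.5 (i) p.74] -/
theorem cat_heq_of_eq {D₁ D₂ : DiagramOfCategories.{v, u, w} V} (h : D₁ = D₂) (a : V) :
    HEq (D₁.cat a) (D₂.cat a) := by
  subst h; rfl

/-- Equal diagrams have the same edge functors (heterogeneously). [cite: MochizukiAbsTopIII2015, Definition 3.5 (i) p.74] -/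
theorem map_heq_of_eq {D₁ D₂ : DiagramOfCategories.{v, u, w} V} (h : D₁ = D₂) {a b : V} (e : a ⟶ b) :
    HEq (D₁.map e) (D₂.map e) := by
  subst h; rfl

/-- Equal diagrams have the same path functors (heterogeneously; Def. 3.5 (i)). [cite: MochizukiAbsTopIII2015, Definition 3.5 (i) p.75] -/
theorem pathFunctor_heq_of_eq {D₁ D₂ : DiagramOfCategories.{v, u, w} V} (h : D₁ = D₂) {a b : V}
    (p : Path a b) : HEq (D₁.pathFunctor p) (D₂.pathFunctor p) := by
  subst h; rfl

variable (D : DiagramOfCategories.{v, u, w} V) (F : V ⥤q V)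

/-- If `F^*𝒟 = 𝒟` then `𝒟_{F v} = 𝒟_v` (as types of objects). [cite: MochizukiAbsTopIII2015, Definition 3.5 (i) p.74] -/
theorem obj_eq_of_comapAlong_eq (hD : D.comapAlong F = D) (a : V) : D.obj (F.obj a) = D.obj a :=
  congrFun (congrArg DiagramOfCategories.obj hD) a

/-- If `F^*𝒟 = 𝒟` then the category structures on `𝒟_{F v}` and `𝒟_v` agree (heterogeneously). [cite: MochizukiAbsTopIII2015, Definition 3.5 (i) p.74] -/
theorem cat_heq_of_comapAlong_eq (hD : D.comapAlong F = D) (a : V) : HEq (D.cat (F.obj a)) (D.cat a) :=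
  cat_heq_of_eq hD a

/-- If `F^*𝒟 = 𝒟` then `𝒟_{F[γ]} ≍ 𝒟_{[γ]}` (Def. 3.5 (i)). [cite: MochizukiAbsTopIII2015, Definition 3.5 (i) p.75] -/
theorem pathFunctor_mapPath_heq (hD : D.comapAlong F = D) {a b : V} (p : Path a b) :
    HEq (D.pathFunctor (F.mapPath p)) (D.pathFunctor p) :=
  (heq_of_eq (D.pathFunctor_comapAlong F p)).symm.trans (pathFunctor_heq_of_eq hD p)

/-! ### The path isomorphisms `Φ_{[γ]}` of a 1-morphism -/

variable {D F}
variable {V' : Type w} [Quiver.{v} V'] {D' : DiagramOfCategories.{v, u, w} V'} {G : V ⥤q V'}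

namespace OneMorphism

/-- **`Φ_{[γ]}`**: the isomorphism `Φ_{v₁} ⋙ 𝒟'_{Φ_Γ⃗[γ]} ≅ 𝒟_{[γ]} ⋙ Φ_{v₂}` along a path, composed from the
2-cells `Φ_e` of a 1-morphism of diagrams (Def. 3.5 (v); the recursion is the one recorded by the clauses
`pathIso_nil`, `pathIso_cons` of `OneMorphism.CompatibleWith`). [cite: MochizukiAbsTopIII2015, Definition 3.5 (v) p.76] -/
noncomputable def pathIso' (Φ : DiagramOfCategories.OneMorphism G D D') : ∀ {a b : V} (p : Path a b),
    Φ.app a ⋙ D'.pathFunctor (G.mapPath p) ≅ D.pathFunctor p ⋙ Φ.app b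
  | a, _, .nil =>
    eqToIso (by rw [Prefunctor.mapPath_nil, pathFunctor_nil]) ≪≫
      ((Φ.app a).rightUnitor ≪≫ (Φ.app a).leftUnitor.symm) ≪≫ eqToIso (by rw [pathFunctor_nil])
  | _, _, .cons p e =>
    eqToIso (by rw [Prefunctor.mapPath_cons, pathFunctor_cons]) ≪≫
      ((Functor.associator _ _ _).symm ≪≫
        Functor.isoWhiskerRight (pathIso' Φ p) (D'.map (G.map e)) ≪≫ Functor.associator _ _ _ ≪≫
        Functor.isoWhiskerLeft (D.pathFunctor p) (Φ.iso e) ≪≫ (Functor.associator _ _ _).symm) ≪≫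
      eqToIso (by rw [pathFunctor_cons])

/-- `Φ_{[γ]}` on the empty path (the clause `pathIso_nil`). [cite: MochizukiAbsTopIII2015, Definition 3.5 (v) p.76] -/
theorem pathIso'_nil (Φ : DiagramOfCategories.OneMorphism G D D') (a : V) :
    Φ.pathIso' (Path.nil : Path a a) =
      eqToIso (by rw [Prefunctor.mapPath_nil, pathFunctor_nil]) ≪≫
        ((Φ.app a).rightUnitor ≪≫ (Φ.app a).leftUnitor.symm) ≪≫ eqToIso (by rw [pathFunctor_nil]) := by
  rw [pathIso']

/-- `Φ_{[γ]}` on an extended path (the clause `pathIso_cons`). [cite: MochizukiAbsTopIII2015, Definition 3.5 (v) p.76] -/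
theorem pathIso'_cons (Φ : DiagramOfCategories.OneMorphism G D D') {a b c : V} (p : Path a b) (e : b ⟶ c) :
    Φ.pathIso' (p.cons e) =
      eqToIso (by rw [Prefunctor.mapPath_cons, pathFunctor_cons]) ≪≫
        ((Functor.associator _ _ _).symm ≪≫
          Functor.isoWhiskerRight (Φ.pathIso' p) (D'.map (G.map e)) ≪≫ Functor.associator _ _ _ ≪≫
          Functor.isoWhiskerLeft (D.pathFunctor p) (Φ.iso e) ≪≫ (Functor.associator _ _ _).symm) ≪≫
        eqToIso (by rw [pathFunctor_cons]) := by
  rw [pathIso']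

/-- `eqToHom` bookkeeping: a composite of two `eqToHom`-like morphisms is `eqToHom`-like. [folklore] -/
private theorem exists_eqToHom_comp {C : Type*} [Category C] {X Y Z : C} {f : X ⟶ Y} {g : Y ⟶ Z} :
    (∃ h, f = eqToHom h) → (∃ h, g = eqToHom h) → ∃ h, f ≫ g = eqToHom h
  | ⟨hf, ef⟩, ⟨hg, eg⟩ => ⟨hf.trans hg, by subst hf; subst hg; simp [ef, eg]⟩

/-- `eqToHom` bookkeeping: an identity is `eqToHom`-like. [folklore] -/
private theorem exists_eqToHom_id {C : Type*} [Category C] (X : C) : ∃ h : X = X, 𝟙 X = eqToHom h :=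
  ⟨rfl, rfl⟩

/-- `eqToHom` bookkeeping: an `eqToHom` is `eqToHom`-like. [folklore] -/
private theorem exists_eqToHom_eqToHom {C : Type*} [Category C] {X Y : C} (h : X = Y) :
    ∃ h' : X = Y, eqToHom h = eqToHom h' :=
  ⟨h, rfl⟩

/-- If the 2-cells `Φ_e` have `eqToHom` components, so do the `Φ_{[γ]}`. [cite: MochizukiAbsTopIII2015, Definition 3.5 (v) p.76] -/
theorem pathIso'_hom_app (Φ : DiagramOfCategories.OneMorphism G D D')
    (hΦ : ∀ ⦃a b : V⦄ (e : a ⟶ b) (x : D.obj a), ∃ h, (Φ.iso e).hom.app x = eqToHom h) {a : V} :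
    ∀ {b : V} (p : Path a b) (x : D.obj a), ∃ h, (Φ.pathIso' p).hom.app x = eqToHom h := by
  intro b p
  induction p with
  | nil =>
    intro x
    rw [pathIso'_nil]
    simp only [Iso.trans_hom, eqToIso.hom, Iso.symm_hom, NatTrans.comp_app, eqToHom_app,
      Functor.rightUnitor_hom_app, Functor.leftUnitor_inv_app]
    repeat' (first
      | exact exists_eqToHom_eqToHom _
      | exact exists_eqToHom_id _
      | refine exists_eqToHom_comp ?_ ?_)
  | cons p e ih =>
    intro x
    obtain ⟨h₁, e₁⟩ := ih x
    obtain ⟨h₂, e₂⟩ := hΦ e ((D.pathFunctor p).obj x)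
    rw [pathIso'_cons]
    simp only [Iso.trans_hom, eqToIso.hom, Iso.symm_hom, NatTrans.comp_app, eqToHom_app,
      Functor.associator_hom_app, Functor.associator_inv_app, Functor.isoWhiskerRight_hom,
      Functor.isoWhiskerLeft_hom, Functor.whiskerRight_app, Functor.whiskerLeft_app, e₁, e₂, eqToHom_map]
    repeat' (first
      | exact exists_eqToHom_eqToHom _
      | exact exists_eqToHom_id _
      | refine exists_eqToHom_comp ?_ ?_)

end OneMorphism

/-! ### Def. 3.5 (v) compatibility from invariance -/

namespace OneMorphism

variable (Φ : DiagramOfCategories.OneMorphism F D D)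

/-- **Def. 3.5 (v) compatibility of a self-equivalence with (a pair of) families of homotopies, from
INVARIANCE.**  Let `Φ : 𝒟 → 𝒟` be a 1-morphism over a graph morphism `F : Γ⃗_𝒟 → Γ⃗_𝒟` under which `𝒟` is
invariant (`F^*𝒟 = 𝒟`), with identity vertex functors `Φ_v ≍ 𝟭` and componentwise-`eqToHom` 2-cells `Φ_e`,
`F` surjective on paths; let `K`, `K'` be families of homotopies on `𝒟` with `E_K(γ₁,γ₂) ↔ E_{K'}(Fγ₁,Fγ₂)`
and `ζ^{K'}_{(Fγ₁,Fγ₂)} ≍ ζ^K_{(γ₁,γ₂)}`.  Then `Φ` is compatible with `K`, `K'` in the sense of Def. 3.5 (v):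
`Φ_Γ⃗` induces a bijection of the boundary sets and the homotopies commute with the `Φ_{[γ]}`.
[cite: MochizukiAbsTopIII2015, Definition 3.5 (v) p.76] -/
noncomputable def compatibleWithOfInvariant (hD : D.comapAlong F = D)
    (happ : ∀ a : V, HEq (Φ.app a) (𝟭 (D.obj a)))
    (hiso : ∀ ⦃a b : V⦄ (e : a ⟶ b) (x : D.obj a), ∃ h, (Φ.iso e).hom.app x = eqToHom h)
    (hsurj : ∀ ⦃a b : V⦄ (p' : Path (F.obj a) (F.obj b)), ∃ p : Path a b, F.mapPath p = p')
    (K K' : D.HomotopyFamily)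
    (hE : ∀ ⦃a b : V⦄ (p q : Path a b), K.E p q ↔ K'.E (F.mapPath p) (F.mapPath q))
    (hη : ∀ ⦃a b : V⦄ ⦃p q : Path a b⦄ (h : K.E p q), HEq (K'.η ((hE p q).mp h)) (K.η h)) :
    Φ.CompatibleWith K K' where
  pathIso p := Φ.pathIso' p
  pathIso_nil a := Φ.pathIso'_nil a
  pathIso_cons p e := Φ.pathIso'_cons p e
  boundary_iff p q := hE p q
  boundary_surj := by
    intro a b p' q' _
    obtain ⟨p, rfl⟩ := hsurj p'
    obtain ⟨q, rfl⟩ := hsurj q'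
    exact ⟨p, q, rfl, rfl⟩
  η_compat := by
    intro a b p q h
    ext x
    obtain ⟨hp, ep⟩ := Φ.pathIso'_hom_app hiso p x
    obtain ⟨hq, eq_⟩ := Φ.pathIso'_hom_app hiso q x
    simp only [NatTrans.comp_app, Functor.whiskerLeft_app, Functor.whiskerRight_app, ep, eq_]
    -- both sides are heterogeneously `ζ^K_{(γ₁,γ₂)}` at `x`
    have hA := D.obj_eq_of_comapAlong_eq F hD a
    have hB := D.obj_eq_of_comapAlong_eq F hD b
    have hiA := D.cat_heq_of_comapAlong_eq F hD a
    have hiB := D.cat_heq_of_comapAlong_eq F hD b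
    have hx : HEq ((Φ.app a).obj x) x := Functor.obj_heq_of_heq_id hA hiA (happ a) x
    have hl : HEq ((K'.η ((hE p q).mp h)).app ((Φ.app a).obj x)) ((K.η h).app x) :=
      NatTrans.app_heq_of_heq hA hiA hB hiB (D.pathFunctor_mapPath_heq F hD p)
        (D.pathFunctor_mapPath_heq F hD q) (hη h) hx
    have hr : HEq ((Φ.app b).map ((K.η h).app x)) ((K.η h).app x) :=
      Functor.map_heq_of_heq_id hB hiB (happ b) _
    have key : HEq ((K'.η ((hE p q).mp h)).app ((Φ.app a).obj x) ≫ eqToHom hq)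
        (eqToHom hp ≫ (Φ.app b).map ((K.η h).app x)) :=
      ((comp_eqToHom_heq _ _).trans (hl.trans hr.symm)).trans (eqToHom_comp_heq _ _).symm
    exact eq_of_heq key

end OneMorphism

/-- **Def. 3.5 (v) compatibility of a self-equivalence with invariant families** (existence form).
[cite: MochizukiAbsTopIII2015, Definition 3.5 (v) p.76] -/
theorem OneMorphism.nonempty_compatibleWith_of_invariant (Φ : DiagramOfCategories.OneMorphism F D D)
    (hD : D.comapAlong F = D) (happ : ∀ a : V, HEq (Φ.app a) (𝟭 (D.obj a)))
    (hiso : ∀ ⦃a b : V⦄ (e : a ⟶ b) (x : D.obj a), ∃ h, (Φ.iso e).hom.app x = eqToHom h)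
    (hsurj : ∀ ⦃a b : V⦄ (p' : Path (F.obj a) (F.obj b)), ∃ p : Path a b, F.mapPath p = p')
    (K K' : D.HomotopyFamily)
    (hE : ∀ ⦃a b : V⦄ (p q : Path a b), K.E p q ↔ K'.E (F.mapPath p) (F.mapPath q))
    (hη : ∀ ⦃a b : V⦄ ⦃p q : Path a b⦄ (h : K.E p q), HEq (K'.η ((hE p q).mp h)) (K.η h)) :
    Nonempty (Φ.CompatibleWith K K') :=
  ⟨Φ.compatibleWithOfInvariant hD happ hiso hsurj K K' hE hη⟩

/-- The boundary-set half of invariance needs only ONE direction for each of a pair of mutually inverse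
graph morphisms: if `E_K(γ₁,γ₂) → E_K(Fγ₁,Fγ₂)` and `E_K(γ₁,γ₂) → E_K(Gγ₁,Gγ₂)` with `F ⋙ G = id`, then
`E_K(γ₁,γ₂) ↔ E_K(Fγ₁,Fγ₂)`. [cite: MochizukiAbsTopIII2015, Definition 3.5 (v) p.76] -/
theorem HomotopyFamily.E_mapPath_iff_of_inverse {F G : V ⥤q V} (h₁ : F ⋙q G = 𝟭q V)
    (E : ∀ ⦃a b : V⦄, Path a b → Path a b → Prop)
    (hF : ∀ ⦃a b : V⦄ ⦃p q : Path a b⦄, E p q → E (F.mapPath p) (F.mapPath q))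
    (hG : ∀ ⦃a b : V⦄ ⦃p q : Path a b⦄, E p q → E (G.mapPath p) (G.mapPath q)) {a b : V}
    (p q : Path a b) : E p q ↔ E (F.mapPath p) (F.mapPath q) := by
  refine ⟨fun h => hF h, fun h => ?_⟩
  have h' := hG h
  rw [← Prefunctor.mapPath_comp_apply, ← Prefunctor.mapPath_comp_apply] at h'
  have aux : ∀ {H : V ⥤q V} (hH : H = 𝟭q V), E (H.mapPath p) (H.mapPath q) → E p q := by
    intro H hH; subst hH; rw [Prefunctor.mapPath_id, Prefunctor.mapPath_id]; exact id
  exact aux h₁ h'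

end DiagramOfCategories

end Literature.AnabelianGeometry.AbsoluteAnabelian
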